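/- Lead `ym-line-cbag-p1`, route `ColdBoxAllGroups`, crux `BoxFloorAllGroups` (stmt-QuantumFields-22254), line `birth`, stub S2, brick B7
«TiltBoundG»: the tilt of the one-scale expansion is uniformly small on the small-link region. -/
import Summits.QuantumFields.YangMills.Theorems.ColdBoxAllGroupsOneScaleDefs
import Summits.QuantumFields.YangMills.Theorems.ColdBoxAllGroupsBoxFloorAllGroupsCubicG

/-!
# Crux `BoxFloorAllGroups`, stub S2, brick B7 «TiltBoundG»: on the small-link region the tilt `tiltWE` is
# `≤ #Λ'·190·β·m³ + #free·ℓ`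

`G`-generic port of `WeakCouplingRatesColdBoxTiltBound` (there: gnomonic chart of `SU(2)`, constants `362βη³` per plaquette and `2η²` per link)
to the exponential chart of a compact group presented in `U(N)` (objects of `Theorems/ColdBoxAllGroupsOneScaleDefs.lean`):

* `norm_extZero_le` — the zero extension of link data of norm `≤ m` has norm `≤ m` everywhere (`0 ≤ m`);
* `norm_sq_circ_extZero_unscaleTE` — the squared Euclidean norm of the LINEAR circulation of the chart coordinates `a = unscaleTE t` around a
  plaquette is `(Σ_i dirCirc H p (t i)²)/β = 2·qObsD p t/β` (`sCirc_extZero_unscaleTE`, colour by colour);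
* **`abs_qObsD_sub_beta_mul_plaqCostAt_le`** — if every chart coordinate has norm `≤ m ≤ 1/4` then, for EVERY plaquette `(x, i, j)` of `ℤ⁴`,
  `|qObsD p t − β·plaqCostAt ρ p (cfgTE ρ H β t)| ≤ 190·β·m³` (the cubic remainder `abs_cost_expChart_holonomy_sub_half_norm_sq_le` of the
  sibling brick «CubicG», w3);
* **`abs_tiltWE_le`** — with a chart density `g` satisfying `|log g(a)| ≤ ℓ` for `‖a‖ ≤ m`:
  `|tiltWE ρ H g β t| ≤ #(plaquettesTouching Λ)·190·β·m³ + #(ColdFreeIdx H)·ℓ` (for the Helgason Jacobian `|J − 1| ≤ C₂‖a‖²` use the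
  tree's `abs_log_le_two_mul` (`|log y| ≤ 2x` from `|y − 1| ≤ x ≤ 1/2`, module `BalabanUV.Beta.EriceFlowEnclosureCesaroClockSamplingRate`)).
With `m ≍ H²β^{ε−1/2}` (forest Poincaré on the small-field event), `#Λ' ≍ H⁴`, `ℓ ≍ m²` (Helgason Jacobian `J = 1 + O(|a|²)`,
`ColdBoxAllGroupsExpChartPackage2Haar`) or `ℓ ≍ D·m` (soft sandwich): tilt `≍ β^{19θ−1/2}` for `ε = 3θ`, as in the `SU(2)` proof.
No sorry; no new definition; standard axioms.  NOT a claim about the mass gap (rung-level support, RECORD label).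
-/

set_option autoImplicit false

noncomputable section

open MeasureTheory Finset
open Literature.Probability.LatticeModels (Site)
open Literature.MathematicalPhysics.QuantumLattice
open Literature.MathematicalPhysics.QuantumFieldTheory
open Literature.MathematicalPhysics.QuantumFieldTheory.LatticeMaxwell
open Literature.MathematicalPhysics.QuantumFieldTheory.AxialGauge
open Summit.QuantumFields.YangMills.Theorems.WeakCouplingRates
open Summit.QuantumFields.YangMills.Theorems.FreeEnergyLogCoefficient

namespace Summit.QuantumFields.YangMills.Theorems.ColdBoxAllGroups

variable {N : ℕ} {G : Type*} [Group G] (ρ : G →* Matrix (Fin N) (Fin N) ℂ) {H : ℕ}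

/-! ## Norms of the zero extension -/

/-- The zero extension of link data of norm `≤ m` (`0 ≤ m`) has norm `≤ m` on every edge of `ℤ⁴`. -/
theorem norm_extZero_le {V : Type*} [SeminormedAddCommGroup V] {w : ColdFreeIdx H → V} {m : ℝ} (hm : 0 ≤ m)
    (hw : ∀ e, ‖w e‖ ≤ m) (e : Literature.MathematicalPhysics.QuantumLattice.ZdEdge 4) : ‖extZero w e‖ ≤ m := by
  unfold extZero
  split_ifs
  · simpa using hm
  · exact hw _
  · simpa using hm

/-! ## The linear circulation of the chart coordinates -/

/-- The squared norm of the linear circulation of `ℝ^D`-valued link data around a plaquette is the sum over the colours of the squared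
scalar circulations. -/
theorem norm_sq_circ_eq_sum {D : ℕ} (A : Literature.MathematicalPhysics.QuantumLattice.ZdEdge 4 → EuclideanSpace ℝ (Fin D))
    (x : Site 4) (i j : Fin 4) :
    ‖A (x, i) + A (x + Pi.single i 1, j) - A (x + Pi.single j 1, i) - A (x, j)‖ ^ 2 =
      ∑ k, sCirc (fun e => A e k) (x, i, j) ^ 2 := by
  rw [EuclideanSpace.real_norm_sq_eq]
  refine Finset.sum_congr rfl fun k _ => ?_
  simp only [sCirc, PiLp.sub_apply, PiLp.add_apply]

/-- **The linear circulation of the chart coordinates is the Dirichlet circulation, unscaled**: for `a = unscaleTE H D β t` and `β > 0`,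
`‖a(x,i) + a(x+eᵢ,j) − a(x+eⱼ,i) − a(x,j)‖² = 2·qObsD H D (x,i,j) t / β` (zero extension understood). -/
theorem norm_sq_circ_extZero_unscaleTE {D : ℕ} {β : ℝ} (hβ : 0 < β) (t : TSpaceD H D) (x : Site 4) (i j : Fin 4) :
    ‖extZero (unscaleTE H D β t) (x, i) + extZero (unscaleTE H D β t) (x + Pi.single i 1, j) -
        extZero (unscaleTE H D β t) (x + Pi.single j 1, i) - extZero (unscaleTE H D β t) (x, j)‖ ^ 2 =
      2 * qObsD H D (x, i, j) t / β := by
  have hs : Real.sqrt β ^ 2 = β := Real.sq_sqrt hβ.le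
  rw [norm_sq_circ_eq_sum, qObsD]
  simp only [sCirc_extZero_unscaleTE, div_pow, hs]
  rw [show (2 : ℝ) * (1 / 2 * ∑ k, dirCirc H (x, i, j) (t k) ^ 2) = ∑ k, dirCirc H (x, i, j) (t k) ^ 2 by ring,
    Finset.sum_div]

/-! ## The cubic remainder per plaquette -/

section Cubic

variable [TopologicalSpace G] [CompactSpace G]

omit [TopologicalSpace G] [CompactSpace G] in
/-- The plaquette cost of the chart configuration, unfolded to the four-link holonomy in the chart. -/
theorem plaqCostAt_cfgTE_eq (β : ℝ) (t : TSpaceD H (dimE ρ)) (x : Site 4) (i j : Fin 4) :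
    plaqCostAt ρ x i j (cfgTE ρ H β t) =
      (N : ℝ) - (ρ (expChart ρ (extZero (unscaleTE H (dimE ρ) β t) (x, i)) *
        expChart ρ (extZero (unscaleTE H (dimE ρ) β t) (x + Pi.single i 1, j)) *
        (expChart ρ (extZero (unscaleTE H (dimE ρ) β t) (x + Pi.single j 1, i)))⁻¹ *
        (expChart ρ (extZero (unscaleTE H (dimE ρ) β t) (x, j)))⁻¹)).trace.re := rfl

/-- **Cubic remainder per plaquette.**  For a continuous unitary-valued `ρ`, `β > 0` and a colour tuple `t` all of whose chart coordinates
`unscaleTE t e` have norm `≤ m ≤ 1/4`: for every plaquette `(x, i, j)` of `ℤ⁴`,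
`|qObsD (x,i,j) t − β·plaqCostAt ρ x i j (cfgTE ρ H β t)| ≤ 190·β·m³`. -/
theorem abs_qObsD_sub_beta_mul_plaqCostAt_le (hρ : Continuous ρ) {β m : ℝ} (hβ : 0 < β) (hm0 : 0 ≤ m) (hm : m ≤ 1 / 4)
    (t : TSpaceD H (dimE ρ)) (ht : ∀ e, ‖unscaleTE H (dimE ρ) β t e‖ ≤ m) (x : Site 4) (i j : Fin 4) :
    |qObsD H (dimE ρ) (x, i, j) t - β * plaqCostAt ρ x i j (cfgTE ρ H β t)| ≤ 190 * β * m ^ 3 := by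
  set a := unscaleTE H (dimE ρ) β t with ha
  have hn : ∀ e, ‖extZero a e‖ ≤ m := norm_extZero_le hm0 ht
  have hcub := abs_cost_expChart_holonomy_sub_half_norm_sq_le ρ hρ (extZero a (x, i)) (extZero a (x + Pi.single i 1, j))
    (extZero a (x + Pi.single j 1, i)) (extZero a (x, j)) hm (hn _) (hn _) (hn _) (hn _)
  rw [norm_sq_circ_extZero_unscaleTE hβ t x i j] at hcub
  rw [plaqCostAt_cfgTE_eq]
  have e : qObsD H (dimE ρ) (x, i, j) t - β * ((N : ℝ) - (ρ (expChart ρ (extZero a (x, i)) *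
      expChart ρ (extZero a (x + Pi.single i 1, j)) * (expChart ρ (extZero a (x + Pi.single j 1, i)))⁻¹ *
      (expChart ρ (extZero a (x, j)))⁻¹)).trace.re) =
      -(β * (((N : ℝ) - (ρ (expChart ρ (extZero a (x, i)) * expChart ρ (extZero a (x + Pi.single i 1, j)) *
        (expChart ρ (extZero a (x + Pi.single j 1, i)))⁻¹ * (expChart ρ (extZero a (x, j)))⁻¹)).trace.re) -
        2 * qObsD H (dimE ρ) (x, i, j) t / β / 2)) := by
    field_simp
    ring
  rw [e, abs_neg, abs_mul, abs_of_pos hβ]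
  calc β * |((N : ℝ) - (ρ (expChart ρ (extZero a (x, i)) * expChart ρ (extZero a (x + Pi.single i 1, j)) *
        (expChart ρ (extZero a (x + Pi.single j 1, i)))⁻¹ * (expChart ρ (extZero a (x, j)))⁻¹)).trace.re) -
        2 * qObsD H (dimE ρ) (x, i, j) t / β / 2| ≤ β * (190 * m ^ 3) := mul_le_mul_of_nonneg_left hcub hβ.le
    _ = 190 * β * m ^ 3 := by ring

/-! ## The tilt bound -/

/-- **The tilt is uniformly small on the small-link region.**  If every chart coordinate of `t` has norm `≤ m ≤ 1/4` and the chart density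
satisfies `|log g(a)| ≤ ℓ` for `‖a‖ ≤ m`, then `|tiltWE ρ H g β t| ≤ #(plaquettesTouching Λ)·190·β·m³ + #(ColdFreeIdx H)·ℓ`. -/
theorem abs_tiltWE_le (hρ : Continuous ρ) {β m ℓ : ℝ} (hβ : 0 < β) (hm0 : 0 ≤ m) (hm : m ≤ 1 / 4)
    {g : EuclideanSpace ℝ (Fin (dimE ρ)) → ℝ} (hg : ∀ a, ‖a‖ ≤ m → |Real.log (g a)| ≤ ℓ)
    (t : TSpaceD H (dimE ρ)) (ht : ∀ e, ‖unscaleTE H (dimE ρ) β t e‖ ≤ m) :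
    |tiltWE ρ H g β t| ≤
      #(plaquettesTouching (boxEdges 4 (2 * H + 1))) * (190 * β * m ^ 3) + Fintype.card (ColdFreeIdx H) * ℓ := by
  unfold tiltWE
  refine (abs_add_le _ _).trans (add_le_add ?_ ?_)
  · refine (Finset.abs_sum_le_sum_abs _ _).trans ?_
    calc ∑ q ∈ plaquettesTouching (boxEdges 4 (2 * H + 1)),
          |qObsD H (dimE ρ) (q.1, q.2.1.1, q.2.1.2) t - β * plaqCostAt ρ q.1 q.2.1.1 q.2.1.2 (cfgTE ρ H β t)|
        ≤ ∑ _q ∈ plaquettesTouching (boxEdges 4 (2 * H + 1)), 190 * β * m ^ 3 :=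
          Finset.sum_le_sum fun q _ => abs_qObsD_sub_beta_mul_plaqCostAt_le ρ hρ hβ hm0 hm t ht _ _ _
      _ = _ := by rw [Finset.sum_const, nsmul_eq_mul]
  · refine (Finset.abs_sum_le_sum_abs _ _).trans ?_
    calc ∑ e : ColdFreeIdx H, |Real.log (g (unscaleTE H (dimE ρ) β t e))| ≤ ∑ _e : ColdFreeIdx H, ℓ :=
          Finset.sum_le_sum fun e _ => hg _ (ht e)
      _ = _ := by rw [Finset.sum_const, Finset.card_univ, nsmul_eq_mul]

end Cubic

end Summit.QuantumFields.YangMills.Theorems.ColdBoxAllGroups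

end
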